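import Summits.AtomisticToContinuum.Crystallization.Theorems.OverbindingBudgetEnergyLayerTailH

/-!
# OverbindingBudget · decomp-a2c lens-4 g34 — part XXII-O: AFFINE STRAIGHTENING — the convexity leaves the analytic side

Helper file under `--supports stmt-AtomisticToContinuum-31280` (RDEF = `Theses.OverbindingBudget.RobustDefectLimitWindows`); closes nothing.

STR `StraightenedFloor Λ₁` (part F) straightens the gap heights of an admissible stacked configuration by JENSEN — which needs the laterally
minimised inter-layer fields `G_s(P) = inf_u layerField a b (P•n + u)` to be (jointly) convex in the heights: an envelope-theorem / non-degenerate
lateral minimiser statement [ANALYTIC·M, UNDECIDED].  This part removes convexity from the analytic side altogether: if the certificate supplies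
AFFINE MINORANTS `α_s + β_s·P ≤ layerField a b (P•n + u)` of the first `s₀` inter-layer fields on the configuration's (thin) band of span heights,
then averaging over a cube is EXACT on the affine side (linear in the heights) — no Jensen, no smoothness, no lateral uniqueness.  The price moves
into the certificate as the convexification loss `Σ_s (G_s − conv G_s)((s+1)h̄) = O(Σ_s |G_s″|((s+1)ω)²)`, negligible once the oscillation `ω` of the
gap heights of ONE admissible configuration is small (GEO-OSC below; zero gap stress makes `ω ≈ 10⁻³` or less, memo §I).

* `AffineBound a b n η₁ η₂ s₀ B h e` — affine minorants with slopes `|β_s| ≤ B` on `[(s+1)η₁, (s+1)η₂]`, `s < s₀`, whose values at the uniform heights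
  `(s+1)h` sum with `φ₀/2` and the tail allowance `22/(21 s₀³ η₁⁴)` of part M to `≥ e`.
* STR-A `AffineStraightenedFloor Λ₁` [ANALYTIC·S, TO BE PROVED (g35): DEC (part N, PROVED) + layer-wise regrouping of the cube sum + the affine
  average (exact) + the slope-bounded drift of the span-wise weighted means `O(B s₀² ω/ℓ)` (shell counting) + far pairs by `layerField_far`]: a
  `δ ≥ 9/10`-separated layered configuration over a cell `‖a‖, ‖b‖ ≤ Λ₁` with unit normal `n` and ALL gap heights in `[η₁, η₂] ⊂ [3/8, 23/20]`, such that
  `AffineBound … h (e + κ″)` holds at every `h ∈ [η₁, η₂]`, has the mean floor `MeanSiteEnergyFloor e` (binders MINIMAL: no cleanliness / Nash / stress).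
* GEO-OSC `StackedHeightsOsc Λ₁ ω` [CERT·S]: the gap heights of an admissible stacked configuration (7d's binders) oscillate by at most `ω`.
* FIN-A-T `AffineCellEnergyT Λ₁ s₁ s₂ ω s₀ B e` / FIN-A-S `AffineSquareExtinct Λ₁ ω s₀ B e` [CERT·M, configuration-free, FINITE]: for every admissible
  unpinned T-cell (every S-cell), unit normal, sub-band `[η₁, η₂] ⊂ [3/8, 23/20]` of width `≤ ω` and `h ∈ [η₁, η₂]`: `AffineBound a b n η₁ η₂ s₀ B h e`.
Seams PROVED: `strainedCellEnergyT_of_affine`, `strainedCellEnergyS_of_affineExtinct`, ★ `stackedCellPinningU_of_affine : 0 < κ′ → Λ₁ ≤ 17/16 → 4 ≤ s₀ →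
STR-A → GEO-OSC(ω) → FIN-A-T(e⋆ + 2κ′) → FIN-A-S(e⋆ + 2κ′) → StackedCellPinningU Λ₁ s₁ s₂ 1 0`; sanity `finTH_of_affine` / `finSH_of_affine` (the affine
certificates imply the plain finite ones of part M: the convexification only costs); cone XXXIV `rdef_thirtyfourth_of_recordK_affine_ref`.
-/

noncomputable section

namespace Summit.AtomisticToContinuum.Crystallization.Theorems.OverbindingBudgetEnergyAffineStraightening

open Real Finset
open scoped RealInnerProductSpace
open Literature.MathematicalPhysics.StatisticalMechanics (lennardJones groundStateEnergy)
open Summit.AtomisticToContinuum.Crystallization.Theses.OverbindingBudget (RobustDefectLimitWindows)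
open Summit.AtomisticToContinuum.Crystallization.Theses.PricedLinkCensus (ChargedEnergyGap)
open Summit.AtomisticToContinuum.Crystallization.Theorems.ChargedEnergyGapNegative (eStar)
open Summit.AtomisticToContinuum.Crystallization.Theorems.OverbindingBudgetGradedBareness (CleanlessExcessT)
open Summit.AtomisticToContinuum.Crystallization.Theorems.OverbindingBudgetCoherentCut (CoherentResidual)
open Summit.AtomisticToContinuum.Crystallization.Theorems.OverbindingBudgetUniformCutStatements (GrossCleanBallsU)
open Summit.AtomisticToContinuum.Crystallization.Theorems.OverbindingBudgetElasticSplitScale (CompressedVirialLaw)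
open Summit.AtomisticToContinuum.Crystallization.Theorems.OverbindingBudgetElasticSplitShear (StressFree)
open Summit.AtomisticToContinuum.Crystallization.Theorems.ChartedPlanarOrderChunkFloor (E3)
open Summit.AtomisticToContinuum.Crystallization.Theorems.ChartedPlanarOrderRigidityDoor (IsNash)
open Summit.AtomisticToContinuum.Crystallization.Theorems.ChartedPlanarOrderDensityDichotomy (μS IsSep)
open Summit.AtomisticToContinuum.Crystallization.Theorems.ChartedPlanarOrderDoorLayered (Layered)
open Summit.AtomisticToContinuum.Crystallization.Theorems.ChartedPlanarOrderProfileSlavingLJ (IsStacked gapStress incr)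
open Summit.AtomisticToContinuum.Crystallization.Theorems.OverbindingBudgetScaleWidening (IsCleanW DoorPeriodicW)
open Summit.AtomisticToContinuum.Crystallization.Theorems.OverbindingBudgetTwoShellShape (TwoShellShape BarlowGluingW)
open Summit.AtomisticToContinuum.Crystallization.Theorems.OverbindingBudgetStackedRigidityW (StackedReductionW GapStressVanishesW)
open Summit.AtomisticToContinuum.Crystallization.Theorems.OverbindingBudgetRegistryCut (IsUnitNormal Pinned RegistryLocalisationW RegistryResidual
  RegistryTube RegistryZeroExists zeroExists_of_residual_tube)
open Summit.AtomisticToContinuum.Crystallization.Theorems.OverbindingBudgetRegistrySquare (PinnedSq)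
open Summit.AtomisticToContinuum.Crystallization.Theorems.OverbindingBudgetRegistryDichotomy (IsTType IsSType RegistryGeometryW BalancedLocus
  registryLocalisationW_of_geometry_locus sqRegistryLocalisationW_of_geometry_height)
open Summit.AtomisticToContinuum.Crystallization.Theorems.OverbindingBudgetRegistryDichotomyCW (RegistryMetricCW)
open Summit.AtomisticToContinuum.Crystallization.Theorems.OverbindingBudgetEnergyPinning (StackedCellPinningU)
open Summit.AtomisticToContinuum.Crystallization.Theorems.OverbindingBudgetEnergyStraightening (layerField StraightBound StraightenedFloor
  StraightCellEnergyT StraightCellEnergyS)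
open Summit.AtomisticToContinuum.Crystallization.Theorems.OverbindingBudgetEnergySquareExtinction (SquareCellsExtinct stackedCellPinningU_of_sqExtinct
  sqRegistryGeometryW_empty sqBalancedHeight_empty sqRegistryMetricCW_empty)
open Summit.AtomisticToContinuum.Crystallization.Theorems.OverbindingBudgetEnergyTubeBox (RegistryPinningP TubeConvexRefP
  rdef_of_grossU_shape_gluing_pinningU_convexRefP_registry)
open Summit.AtomisticToContinuum.Crystallization.Theorems.OverbindingBudgetEnergyFinCert (StraightCellEnergyFinT SquareCellsExtinctFin
  LayerFieldTailSum stackedCellPinningU_of_finCert)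
open Summit.AtomisticToContinuum.Crystallization.Theorems.OverbindingBudgetEnergyLayerTail (layerField_bounds)
open Summit.AtomisticToContinuum.Crystallization.Theorems.OverbindingBudgetEnergyFinCert (straightBound_of_fin_tail layerFieldTailSum_mono)
open Summit.AtomisticToContinuum.Crystallization.Theorems.OverbindingBudgetEnergyLayerTailSum (gram_ge_of_cell layerField_far tsum_inv_pow_four_le)
open Summit.AtomisticToContinuum.Crystallization.Theorems.OverbindingBudgetEnergyPinningCut (MeanSiteEnergyFloor StrainedCellEnergyT StrainedCellEnergyS)
open Summit.AtomisticToContinuum.Crystallization.Theorems.OverbindingBudgetEnergyPinningStar (stackedCellPinningU_of_cellEnergy_eStar)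
open Summit.AtomisticToContinuum.Crystallization.Theorems.OverbindingBudgetEnergyStraightening (StackedHeights exists_unitNormal_of_isStacked
  le_norm_latticeVec_of_isSep)
open Summit.AtomisticToContinuum.Crystallization.Theorems.OverbindingBudgetEnergyStraighteningHeights (stackedHeights_holds)
open Summit.AtomisticToContinuum.Crystallization.Theorems.OverbindingBudgetEnergyLayerTailH (StraightCellEnergyFinTH SquareCellsExtinctFinH)

/-! ## §1 The affine-minorant leaves -/

/-- **`AffineBound a b n η₁ η₂ s₀ B h e`** — the AFFINE-MINORANT form of `StraightBound`: affine minorants `α s + β s·P ≤ layerField a b (P•n + u)` of the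
first `s₀` inter-layer fields, valid for every lateral offset `u ⊥ n` and every span height `P ∈ [(s+1)η₁, (s+1)η₂]`, with slopes `|β s| ≤ B`, whose values
at the uniform heights `(s+1)h` sum — with the in-plane self field `φ₀/2` and against the tail allowance `22/(21 s₀³ η₁⁴)` of part M — to at least `e`. -/
def AffineBound (a b n : E3) (η₁ η₂ : ℝ) (s₀ : ℕ) (B h e : ℝ) : Prop :=
  ∃ α β : ℕ → ℝ, (∀ s : ℕ, s < s₀ → |β s| ≤ B) ∧
    (∀ s : ℕ, s < s₀ → ∀ P : ℝ, ((s : ℝ) + 1) * η₁ ≤ P → P ≤ ((s : ℝ) + 1) * η₂ → ∀ u : E3, ⟪u, n⟫ = 0 →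
      α s + β s * P ≤ layerField a b (P • n + u)) ∧
    e + 22 / (21 * (s₀ : ℝ) ^ 3 * η₁ ^ 4) ≤ layerField a b 0 / 2 + ∑ s ∈ range s₀, (α s + β s * (((s : ℝ) + 1) * h))

/-- **STR-A · `AffineStraightenedFloor Λ₁`** [ANALYTIC·S, to be proved at `Λ₁ ≤ 17/16`]: AFFINE STRAIGHTENING.  A `δ ≥ 9/10`-separated layered configuration
over a cell `‖a‖, ‖b‖ ≤ Λ₁` (`a, b` independent) with unit normal `n` and all gap heights in `[η₁, η₂] ⊂ [3/8, 23/20]`, satisfying `AffineBound … h (e + κ″)`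
at every `h ∈ [η₁, η₂]` (`κ″ > 0`, `s₀ ≥ 4`, slope bound `B`), has the mean floor `MeanSiteEnergyFloor e`.  Why it might fail: it does not — by DEC
(`…EnergySiteDecomposition.siteEnergy_stacked`) the cube sum regroups layer by layer; the affine side averages EXACTLY; the span-wise weighted height
means drift by `O(s ω/ℓ)` (shell counting), costing `≤ B s₀² ω C/ℓ → 0`; far pairs `≥ −(22/7)/P⁴` (`layerField_far`) give the allowance. [piece] -/
def AffineStraightenedFloor (Λ₁ : ℝ) : Prop :=
  ∀ δ : ℝ, 9 / 10 ≤ δ → ∀ (a b : E3) (w : ℤ → E3), LinearIndependent ℝ ![a, b] → ‖a‖ ≤ Λ₁ → ‖b‖ ≤ Λ₁ → IsSep δ (Layered a b w) →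
    ∀ n : E3, IsUnitNormal a b n → ∀ η₁ η₂ : ℝ, 3 / 8 ≤ η₁ → η₂ ≤ 23 / 20 → (∀ m : ℤ, η₁ ≤ ⟪incr w m, n⟫ ∧ ⟪incr w m, n⟫ ≤ η₂) →
    ∀ e κ'' : ℝ, 0 < κ'' → ∀ s₀ : ℕ, 4 ≤ s₀ → ∀ B : ℝ, (∀ h ∈ Set.Icc η₁ η₂, AffineBound a b n η₁ η₂ s₀ B h (e + κ'')) →
    MeanSiteEnergyFloor e (Layered a b w)

/-- **GEO-OSC · `StackedHeightsOsc Λ₁ ω`** [CERT·S]: the gap heights of an admissible stacked configuration (7d's binders verbatim) lie in SOME band of width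
`≤ ω`.  Mechanism: zero normal gap stress puts every height near the zero of the adjacent-layer normal force (stiffness `k₀ ≈ 14–21`), the far-layer forces
being small and varying only through the heights themselves (`sup − inf` argument: `ω ≤ (lateral effect)/(k₀ − Lip_far)`); zero lateral stress +
clean-W put the registries at hollow sites.  Why it might fail: only numerically (a first localisation to the monotone region of the adjacent force is
needed before the `sup/inf` step). [piece] -/
def StackedHeightsOsc (Λ₁ ω : ℝ) : Prop :=
  ∀ δ : ℝ, 9 / 10 ≤ δ → ∀ (a b : E3) (w : ℤ → E3), IsStacked a b w → LinearIndependent ℝ ![a, b] →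
    ‖a‖ ≤ Λ₁ → ‖b‖ ≤ Λ₁ → IsSep δ (Layered a b w) → IsCleanW (μS (Layered a b w)) → IsNash (μS (Layered a b w)) →
    StressFree (Layered a b w) → (∀ m : ℤ, gapStress a b m (incr w) = 0) →
    ∀ n : E3, IsUnitNormal a b n → (∀ m : ℤ, 0 < ⟪incr w m, n⟫) →
    ∃ η₁ η₂ : ℝ, η₂ - η₁ ≤ ω ∧ ∀ m : ℤ, η₁ ≤ ⟪incr w m, n⟫ ∧ ⟪incr w m, n⟫ ≤ η₂

/-- **FIN-A-T · `AffineCellEnergyT Λ₁ s₁ s₂ ω s₀ B e`** [CERT·M, configuration-free, FINITE]: for every near-triangular admissible cell NOT pinned in `[s₁, s₂]`,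
every unit normal, every sub-band `[η₁, η₂] ⊂ [3/8, 23/20]` of width `≤ ω` and every `h ∈ [η₁, η₂]`: `AffineBound a b n η₁ η₂ s₀ B h e`.  Why it might fail:
numerically — the margin of FIN-T minus the convexification loss `Σ_{s<s₀} (G_s − conv G_s)((s+1)h) = O(Σ_s |G_s″|((s+1)ω)²/8)` (`≈ 2.6·10⁻⁴·(ω/0.03)²`
at the census numbers; negligible for `ω ≤ 10⁻²`). [piece] -/
def AffineCellEnergyT (Λ₁ s₁ s₂ ω : ℝ) (s₀ : ℕ) (B e : ℝ) : Prop :=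
  ∀ (a b n : E3), LinearIndependent ℝ ![a, b] → ‖a‖ ≤ Λ₁ → ‖b‖ ≤ Λ₁ →
    (∀ i j : ℤ, ((i : ℝ) • a + (j : ℝ) • b) ≠ 0 → 9 / 10 ≤ ‖(i : ℝ) • a + (j : ℝ) • b‖) → IsUnitNormal a b n → IsTType a b →
    ¬ Pinned s₁ s₂ a b → ∀ η₁ η₂ : ℝ, 3 / 8 ≤ η₁ → η₂ ≤ 23 / 20 → η₂ - η₁ ≤ ω →
    ∀ h ∈ Set.Icc η₁ η₂, AffineBound a b n η₁ η₂ s₀ B h e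

/-- **FIN-A-S · `AffineSquareExtinct Λ₁ ω s₀ B e`** [CERT·M, configuration-free, FINITE]: the same over every near-square admissible cell, with NO box (square
extinction, part H). [piece] -/
def AffineSquareExtinct (Λ₁ ω : ℝ) (s₀ : ℕ) (B e : ℝ) : Prop :=
  ∀ (a b n : E3), LinearIndependent ℝ ![a, b] → ‖a‖ ≤ Λ₁ → ‖b‖ ≤ Λ₁ →
    (∀ i j : ℤ, ((i : ℝ) • a + (j : ℝ) • b) ≠ 0 → 9 / 10 ≤ ‖(i : ℝ) • a + (j : ℝ) • b‖) → IsUnitNormal a b n → IsSType a b →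
    ∀ η₁ η₂ : ℝ, 3 / 8 ≤ η₁ → η₂ ≤ 23 / 20 → η₂ - η₁ ≤ ω →
    ∀ h ∈ Set.Icc η₁ η₂, AffineBound a b n η₁ η₂ s₀ B h e

/-! ## §2 Seams (PROVED) -/

/-- the band bookkeeping: GEO `[3/8, 23/20]` ∩ an oscillation band of width `≤ ω` is a sub-band of `[3/8, 23/20]` of width `≤ ω` containing all heights. -/
theorem subband_of_geo_osc {h : ℤ → ℝ} {η₁' η₂' ω : ℝ} (hG : ∀ m, 3 / 8 ≤ h m ∧ h m ≤ 23 / 20) (hω : η₂' - η₁' ≤ ω)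
    (hO : ∀ m, η₁' ≤ h m ∧ h m ≤ η₂') :
    3 / 8 ≤ max η₁' (3 / 8) ∧ min η₂' (23 / 20) ≤ 23 / 20 ∧ min η₂' (23 / 20) - max η₁' (3 / 8) ≤ ω ∧
      ∀ m, max η₁' (3 / 8) ≤ h m ∧ h m ≤ min η₂' (23 / 20) := by
  refine ⟨le_max_right _ _, min_le_right _ _, ?_, fun m => ⟨max_le (hO m).1 (hG m).1, le_min (hO m).2 (hG m).2⟩⟩
  linarith [min_le_left η₂' (23 / 20), le_max_left η₁' (3 / 8)]

/-- ★ **E2T from the affine cut.** [this file] -/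
theorem strainedCellEnergyT_of_affine {Λ₁ s₁ s₂ ω B e κ'' : ℝ} {s₀ : ℕ} (hκ : 0 < κ'') (hs₀ : 4 ≤ s₀) (hSTR : AffineStraightenedFloor Λ₁)
    (hGEO : StackedHeights Λ₁ (3 / 8) (23 / 20)) (hOSC : StackedHeightsOsc Λ₁ ω) (hFIN : AffineCellEnergyT Λ₁ s₁ s₂ ω s₀ B (e + κ'')) :
    StrainedCellEnergyT Λ₁ s₁ s₂ e := by
  intro δ hδ a b w hst hab ha hb hs hc hna hf hz hT hnp
  obtain ⟨n, hn, hpos⟩ := exists_unitNormal_of_isStacked hst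
  have hlat : ∀ i j : ℤ, ((i : ℝ) • a + (j : ℝ) • b) ≠ 0 → 9 / 10 ≤ ‖(i : ℝ) • a + (j : ℝ) • b‖ :=
    fun i j hij => hδ.trans (le_norm_latticeVec_of_isSep hs i j hij)
  obtain ⟨η₁', η₂', hω, hO⟩ := hOSC δ hδ a b w hst hab ha hb hs hc hna hf hz n hn hpos
  obtain ⟨h38, h2320, hω', hband⟩ := subband_of_geo_osc (hGEO δ hδ a b w hst hab ha hb hs hc hna hf hz n hn hpos) hω hO
  exact hSTR δ hδ a b w hab ha hb hs n hn _ _ h38 h2320 hband e κ'' hκ s₀ hs₀ B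
    fun x hx => hFIN a b n hab ha hb hlat hn hT hnp _ _ h38 h2320 hω' x hx

/-- ★ **E2S (any box) from the affine cut with square extinction.** [this file] -/
theorem strainedCellEnergyS_of_affineExtinct {Λ₁ ω B e κ'' : ℝ} {s₀ : ℕ} (hκ : 0 < κ'') (hs₀ : 4 ≤ s₀) (hSTR : AffineStraightenedFloor Λ₁)
    (hGEO : StackedHeights Λ₁ (3 / 8) (23 / 20)) (hOSC : StackedHeightsOsc Λ₁ ω) (hX : AffineSquareExtinct Λ₁ ω s₀ B (e + κ'')) (t₁ t₂ : ℝ) :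
    StrainedCellEnergyS Λ₁ t₁ t₂ e := by
  intro δ hδ a b w hst hab ha hb hs hc hna hf hz hS hnp
  obtain ⟨n, hn, hpos⟩ := exists_unitNormal_of_isStacked hst
  have hlat : ∀ i j : ℤ, ((i : ℝ) • a + (j : ℝ) • b) ≠ 0 → 9 / 10 ≤ ‖(i : ℝ) • a + (j : ℝ) • b‖ :=
    fun i j hij => hδ.trans (le_norm_latticeVec_of_isSep hs i j hij)
  obtain ⟨η₁', η₂', hω, hO⟩ := hOSC δ hδ a b w hst hab ha hb hs hc hna hf hz n hn hpos
  obtain ⟨h38, h2320, hω', hband⟩ := subband_of_geo_osc (hGEO δ hδ a b w hst hab ha hb hs hc hna hf hz n hn hpos) hω hO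
  exact hSTR δ hδ a b w hab ha hb hs n hn _ _ h38 h2320 hband e κ'' hκ s₀ hs₀ B
    fun x hx => hX a b n hab ha hb hlat hn hS _ _ h38 h2320 hω' x hx

/-- ★ **★ from the affine cut:** STR-A ∧ GEO-OSC(ω) ∧ FIN-A-T(e⋆ + 2κ′) ∧ FIN-A-S(e⋆ + 2κ′) ⇒ `StackedCellPinningU Λ₁ s₁ s₂ 1 0` (`0 < κ′`, `Λ₁ ≤ 17/16`, `4 ≤ s₀`;
GEO `[3/8, 23/20]` is `stackedHeights_holds`). [this file] -/
theorem stackedCellPinningU_of_affine {Λ₁ s₁ s₂ ω B κ' : ℝ} {s₀ : ℕ} (hκ' : 0 < κ') (hΛ₁ : Λ₁ ≤ 17 / 16) (hs₀ : 4 ≤ s₀)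
    (hSTR : AffineStraightenedFloor Λ₁) (hOSC : StackedHeightsOsc Λ₁ ω) (hT : AffineCellEnergyT Λ₁ s₁ s₂ ω s₀ B (eStar + 2 * κ'))
    (hX : AffineSquareExtinct Λ₁ ω s₀ B (eStar + 2 * κ')) : StackedCellPinningU Λ₁ s₁ s₂ 1 0 := by
  have e2 : eStar + 2 * κ' = eStar + κ' + κ' := by ring
  rw [e2] at hT hX
  exact stackedCellPinningU_of_cellEnergy_eStar hκ' hΛ₁ (strainedCellEnergyT_of_affine hκ' hs₀ hSTR (stackedHeights_holds hΛ₁) hOSC hT)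
    (strainedCellEnergyS_of_affineExtinct hκ' hs₀ hSTR (stackedHeights_holds hΛ₁) hOSC hX 1 0)

/-! ## §3 Sanity: the affine certificates imply the plain finite certificates of part M (the convexification only costs) -/

/-- an `AffineBound` on the degenerate band `[h, h]` bounds the truncated straightened energy at the uniform heights `(s+1)h`. [this file] -/
theorem sum_le_of_affineBound {a b n : E3} {s₀ : ℕ} {B h e : ℝ} (hn : IsUnitNormal a b n) (hA : AffineBound a b n h h s₀ B h e)
    (v : ℕ → E3) (hv : ∀ s : ℕ, ⟪v s, n⟫ = ((s : ℝ) + 1) * h) :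
    e + 22 / (21 * (s₀ : ℝ) ^ 3) * (h ^ 4)⁻¹ ≤ layerField a b 0 / 2 + ∑ s ∈ range s₀, layerField a b (v s) := by
  obtain ⟨α, β, -, hmin, hsum⟩ := hA
  have hnn : ⟪n, n⟫ = 1 := by rw [real_inner_self_eq_norm_sq, hn.1, one_pow]
  have hterm : ∀ s ∈ range s₀, α s + β s * (((s : ℝ) + 1) * h) ≤ layerField a b (v s) := by
    intro s hs
    have hu : ⟪v s - (((s : ℝ) + 1) * h) • n, n⟫ = 0 := by rw [inner_sub_left, inner_smul_left, hv s, hnn]; simp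
    have := hmin s (mem_range.1 hs) (((s : ℝ) + 1) * h) le_rfl le_rfl _ hu
    rwa [add_sub_cancel] at this
  have hc : 22 / (21 * (s₀ : ℝ) ^ 3 * h ^ 4) = 22 / (21 * (s₀ : ℝ) ^ 3) * (h ^ 4)⁻¹ := by rw [← div_div, div_eq_mul_inv]
  rw [← hc]
  exact hsum.trans (by linarith [sum_le_sum hterm])

/-- FIN-A-T ⇒ FIN-TH (`0 ≤ ω`). [this file] -/
theorem finTH_of_affine {Λ₁ s₁ s₂ ω B e : ℝ} {s₀ : ℕ} (hω : 0 ≤ ω) (h : AffineCellEnergyT Λ₁ s₁ s₂ ω s₀ B e) :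
    StraightCellEnergyFinTH Λ₁ (3 / 8) (23 / 20) s₁ s₂ s₀ e (22 / (21 * (s₀ : ℝ) ^ 3)) :=
  fun a b n hab ha hb hlat hn hT hnp x h₁ h₂ v hv =>
    sum_le_of_affineBound hn (h a b n hab ha hb hlat hn hT hnp x x h₁ h₂ (by linarith) x ⟨le_rfl, le_rfl⟩) v hv

/-- FIN-A-S ⇒ FIN-SH (`0 ≤ ω`). [this file] -/
theorem finSH_of_affine {Λ₁ ω B e : ℝ} {s₀ : ℕ} (hω : 0 ≤ ω) (h : AffineSquareExtinct Λ₁ ω s₀ B e) :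
    SquareCellsExtinctFinH Λ₁ (3 / 8) (23 / 20) s₀ e (22 / (21 * (s₀ : ℝ) ^ 3)) :=
  fun a b n hab ha hb hlat hn hS x h₁ h₂ v hv =>
    sum_le_of_affineBound hn (h a b n hab ha hb hlat hn hS x x h₁ h₂ (by linarith) x ⟨le_rfl, le_rfl⟩) v hv

/-! ## §4 Cone XXXIV: beneath ★ the open leaves are STR-A [ANALYTIC·S], GEO-OSC [CERT·S], FIN-A-T / FIN-A-S [finite CERT·M] -/

/-- ★ **RDEF cone, THIRTY-FOURTH form at the numbers of record: ENERGY PINNING through AFFINE STRAIGHTENING** (W′ currency, boxed tube leaves of part I):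
beneath 7d the open energy leaves are STR-A `AffineStraightenedFloor (17/16)` [ANALYTIC·S — no convexity], GEO-OSC `StackedHeightsOsc (17/16) ω` [CERT·S] and
the finite affine certificates FIN-A-T `AffineCellEnergyT (17/16) s₁ s₂ ω s₀ B (e⋆ + 2κ′)`, FIN-A-S `AffineSquareExtinct (17/16) ω s₀ B (e⋆ + 2κ′)` [CERT·M];
E1, ETB(e⋆), GEO, TAIL, DEC PROVED; `κ′, s₁, s₂, h₀, ω, s₀ ≥ 4, B` SYMBOLIC (census). [this file] -/
theorem rdef_thirtyfourth_of_recordK_affine_ref (s₁ s₂ h₀ κ' ω B : ℝ) (s₀ : ℕ) (hκ' : 0 < κ') (hs₀ : 4 ≤ s₀)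
    (hG : GrossCleanBallsU (1 / 250) 10)
    (hCEG : ChargedEnergyGap) (hC : CompressedVirialLaw (1 / 250) 10) (hS : TwoShellShape (1 / 100) (3 / 50) (1 / 450)) (hB₂ : BarlowGluingW)
    (hD : DoorPeriodicW 2) (hSR : StackedReductionW 2 (17 / 16)) (hV : GapStressVanishesW (17 / 16))
    (hP : RegistryPinningP (17 / 16) (1 / 40) (3 / 16) s₁ s₂ 1 0) (hT : TubeConvexRefP (17 / 16) (1 / 40) s₁ s₂ 1 0)
    (hSTR : AffineStraightenedFloor (17 / 16)) (hOSC : StackedHeightsOsc (17 / 16) ω)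
    (hFT : AffineCellEnergyT (17 / 16) s₁ s₂ ω s₀ B (eStar + 2 * κ')) (hFS : AffineSquareExtinct (17 / 16) ω s₀ B (eStar + 2 * κ'))
    (hGeo : RegistryGeometryW (17 / 16) s₁ s₂ h₀ (3 / 20))
    (hBal : BalancedLocus s₁ s₂ h₀ (1 / 40)) (hR1 : RegistryResidual s₁ s₂ (1 / 250)) (hR2 : RegistryTube s₁ s₂ (1 / 100) 1)
    (hMet : RegistryMetricCW s₁ s₂ (3 / 500)) (hCE : CleanlessExcessT) (hRes : CoherentResidual 10) : RobustDefectLimitWindows :=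
  rdef_of_grossU_shape_gluing_pinningU_convexRefP_registry 2 (17 / 16) (1 / 40) (3 / 16) s₁ s₂ 1 0 (7 / 40) (3 / 500) 0 (1 / 100) (4 / 25) 0
    (by norm_num) (by norm_num) le_rfl (by norm_num) hG hCEG hC hS hB₂ hD hSR hV hP hT
    (stackedCellPinningU_of_affine hκ' le_rfl hs₀ hSTR hOSC hFT hFS)
    (registryLocalisationW_of_geometry_locus (by norm_num) hGeo hBal)
    (zeroExists_of_residual_tube (by norm_num) (by norm_num) (by norm_num) (by norm_num) (by norm_num) (by norm_num) hR1 hR2) hMet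
    (sqRegistryLocalisationW_of_geometry_height (by norm_num) (sqRegistryGeometryW_empty (17 / 16) 0 (3 / 20)) (sqBalancedHeight_empty 0 (1 / 100)))
    (sqRegistryMetricCW_empty 0 (1 / 100) 0) hCE hRes

end Summit.AtomisticToContinuum.Crystallization.Theorems.OverbindingBudgetEnergyAffineStraightening

end
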